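import Literature.NumberTheory.EllipticCurves.SexticTwistLSeriesCoefficients
import Literature.NumberTheory.EllipticCurves.ComplexMultiplicationDeuring0Square
import Literature.NumberTheory.QuadraticFields.GaussianPrimary
import HarnessLib

/-!
# The split Euler factors of `L(E^k, s)`, `E^k : y² = x³ + k`: `a_p = σ(χ) + σ(χ)‾`, `χ = (k/p)·(4k/𝔭)₃·ϖ_𝔭`
# (Ireland–Rosen Ch. 18 §3 Theorem 4)

Topic `Literature/NumberTheory/EllipticCurves`, namespace `Literature.NumberTheory.EllipticCurves.SexticTwist`; sequel (§4) of
`SexticTwistLSeriesCoefficients` (§§1–3: the model, the additive primes, the inert primes).  Theorems only (no definition, no named fact).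

For a prime `p ≡ 1 (3)` with `p ∤ k`, a prime `𝔭` of `K = ℚ(ω)` (`IsCyclotomicExtension {3} ℚ K`) over `p` of degree one,
`ϖ = ϖ_𝔭 ≡ 1 (mod 3)` its primary generator (Ireland–Rosen Prop. 9.3.5) and any embedding `σ : K → ℂ`:

* `lFunction_apply_prime_eq_neg_sum` — `a_p(E^k) = −Σ_x ρ(x³ + k)` over `𝔽_p` (`ρ` the quadratic character; `p ∤ 6k`);
* ★ `lFunction_apply_prime_split` — **`a_p(E^k) = z + z̄` with `z = (k/p) · σ((4k/𝔭)₃) · σ(ϖ)`** (`(k/p)` the Legendre symbol,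
  `(·/𝔭)₃ = cubicResidueSymbol 𝔭`), and `σ(ϖ)\overline{σ(ϖ)} = p`.  This is Ireland–Rosen's Theorem 18.4
  «`N_p = p + 1 + \overline{(4D/π)}₆ π + (4D/π)₆ π̄`» (`π ≡ 2 (3)` primary, i.e. `π = −ϖ`): `(a/𝔭)₆⁻¹ = (a/𝔭)₃ · (a/𝔭)₂` and
  `(k/𝔭)₂ = (k/p)` at a prime of degree one, so `−\overline{(4k/π)₆} π = (k/p)(4k/𝔭)₃ ϖ`.  It is the un-squared form of the tree's
  `frobeniusTrace_sq_of_j_eq_zero` (`ComplexMultiplicationDeuring0Square`, there for a globally minimal `W` with `j = 0`) and has the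
  same proof: Ireland–Rosen's count `Σ_x ρ(x³ + B) = cJ(χ, ρ) + \overline{cJ}`, `c = ρ(B)χ(−B)`, for `χ = σ ∘ χ_𝔭` transported to
  `𝔽_p` (`sum_quadraticChar_cube_add`), `J(χ, ρ) = χ(4)J(χ, χ)` (`jacobiSum_quadraticChar_eq_mul_jacobiSum_self`) and
  `J(χ_𝔭, χ_𝔭) = −ϖ_𝔭` (Ch. 9 §4 Lemma 1, `cubicJacobiSum_eq_neg_of_span_eq`), `|cJ|² = p`, `χ(−1) = 1`;
* `lFunction_apply_prime_pow_split` — the Euler factor `(1 − z p^{−s})(1 − z̄ p^{−s})`: `a_{p^j}(E^k) = Σ_{i ≤ j} z^i z̄^{j−i}`.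

With §§2–3 of the prequel these are all the Euler factors of Ireland–Rosen's «`L(E, s) = L(s, χ)`» for `y² = x³ + D` (Ch. 18 §7),
read on Mathlib's `WeierstrassCurve.LFunction`; the weight-one character is `𝔭 ↦ (k/N𝔭) (4k/𝔭)₃ ϖ_𝔭` on the primes `𝔭 ∤ 6k` of `ℤ[ω]`
(and `(p) ↦ −p` at the inert ones).  Filed for the BED route of `Summits/BirchSwinnertonDyer` (crux `ManinDatumSupercuspidalCMInert`,
stub `S5`); nothing about BSD is proved here.

## References
* K. Ireland, M. Rosen, *A Classical Introduction to Modern Number Theory*, 2nd ed., GTM 84 (1990), Ch. 18 §3 Theorem 4 and its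
  proof (PDF pp. 298–299), §7; Ch. 9 §3 Prop. 9.3.5, §4 Lemma 1. [IrelandRosen1990]
* F. Diamond, J. Shurman, *A First Course in Modular Forms*, GTM 228, §8.8 (8.44). [DiamondShurman2005]

## Mathlib / tree search
Tree: `SexticTwistLSeriesCoefficients` (§§1–3: `map_mordellCurve_intCast/_zmod`, `hasGoodReductionAt_of_not_dvd`, `exists_natGenerator_eq`);
`sum_quadraticChar_cube_add`, `jacobiSum_mul_conj`, `conj_apply_eq_sq`, `apply_pow_three_eq_one`, `conj_eq_inv_of_pow_eq_one`,
`quadraticChar_ringEquiv_apply`, `two_three_ne_zero_zmod` (`ComplexMultiplicationDeuring0Proofs/Square`); `cubicResidueChar`,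
`cubicResidueChar_pow_three`, `cubicResidueSymbol_spec`, `three_dvd_residueCard_sub_one`, `residueCard_sub_one_div_three_ne_zero`
(`CubicResidueSymbol`); `cubicJacobiSum_eq`, `charP_quotient_of_natCast_mem`, `three_not_mem_of_natCast_mem` (`CubicReciprocityRationalPrime`);
`jacobiSum_quadraticChar_eq_mul_jacobiSum_self`, `cubicJacobiSum_eq_neg_of_span_eq` (`CubicJacobiSumPrimary`);
`HasseElementary.natCard_point_eq/numY_eq/eval_cubic`; `GaussianPrimary.sum_pow_mul_pow_rec`; `isElliptic_mordellCurve_zmod`,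
`not_dvd_mordellCurve_Δ`.  Mathlib: `legendreSym`, `legendreSym.sq_one`, `ZMod.ringEquivOfPrime`, `jacobiSum_ringHomComp`,
`quadraticChar_dichotomy`, `orderOf_eq_prime`, `IsCyclic.exists_generator`.
-/

noncomputable section

open scoped Classical ComplexConjugate

open WeierstrassCurve IsDedekindDomain NumberField Rat.HeightOneSpectrum Finset
open Literature.NumberTheory.GaloisRepresentations Literature.NumberTheory.DiophantineGeometry

namespace Literature.NumberTheory.EllipticCurves

namespace SexticTwist

variable {k : ℤ}

/-- The finite place of `ℚ` under a rational prime. [folklore] -/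
private theorem exists_natGenerator_eq' {p : ℕ} (hp : p.Prime) : ∃ v : HeightOneSpectrum (𝓞 ℚ), natGenerator v = p :=
  ⟨primesEquiv.symm ⟨p, hp⟩, congrArg Subtype.val ((primesEquiv (R := 𝓞 ℚ)).apply_symm_apply ⟨p, hp⟩)⟩

/-! ### §4 The split primes `p ≡ 1 (3)`: `a_p = σ(χ) + σ(χ)‾`, `χ = (k/p) · (4k/𝔭)₃ · ϖ_𝔭` -/

section Split

variable {K : Type*} [Field K] [NumberField K]
variable {ζ : 𝓞 K} (hζ : IsPrimitiveRoot ζ 3)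

/-- `a_p(E^k) = −Σ_x ρ(x³ + k)` over `𝔽_p` for a prime `p ∤ 6k` (`ρ` the quadratic character): the `ℤ`-model has `p ∤ Δ`, so the
coefficient is `p + 1 − #Ẽ(𝔽_p)` and `#Ẽ(𝔽_p) = 1 + Σ_x (1 + ρ(x³ + k))`.
[cite: IrelandRosen1990, Ch. 18 §3, proof of Theorem 4 (PDF p. 298)] -/
theorem lFunction_apply_prime_eq_neg_sum {p : ℕ} [Fact p.Prime] (h2 : p ≠ 2) (h3 : p ≠ 3) (hpk : ¬ (p : ℤ) ∣ k) :
    (mordellCurve (k : ℚ)).LFunction p = -∑ x : ZMod p, (quadraticChar (ZMod p) (x ^ 3 + (k : ZMod p)) : ℤ) := by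
  have hp : p.Prime := Fact.out
  rw [← map_mordellCurve_intCast,
    Literature.NumberTheory.Automorphic.lFunction_map_apply_prime_of_not_dvd _ hp (not_dvd_mordellCurve_Δ hp h2 h3 hpk),
    Literature.NumberTheory.Automorphic.frobeniusTrace, Literature.NumberTheory.Automorphic.numPointsMod,
    map_mordellCurve_zmod]
  haveI : (mordellCurve (k : ZMod p)).IsShortNF := ⟨rfl, rfl, rfl⟩
  haveI := isElliptic_mordellCurve_zmod h2 h3 hpk
  have hpF : ringChar (ZMod p) ≠ 2 := by rw [ZMod.ringChar_zmod_n]; exact h2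
  rw [Literature.NumberTheory.EllipticCurves.HasseElementary.natCard_point_eq]
  push_cast
  have hnum : ∀ x : ZMod p, ((Literature.NumberTheory.EllipticCurves.HasseElementary.numY (mordellCurve (k : ZMod p)) x : ℕ) : ℤ)
      = (quadraticChar (ZMod p) (x ^ 3 + (k : ZMod p)) : ℤ) + 1 := fun x ↦ by
    rw [Literature.NumberTheory.EllipticCurves.HasseElementary.numY_eq _ hpF,
      Literature.NumberTheory.EllipticCurves.HasseElementary.eval_cubic]
    simp [mordellCurve]
    congr!
  simp_rw [hnum]
  rw [sum_add_distrib, sum_const, card_univ, ZMod.card p, nsmul_eq_mul, mul_one]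
  ring

/-- A cubic character takes the value `1` at `−1` (`χ(−1)² = χ(1) = 1` and `χ(−1)³ = 1`). [folklore] -/
private theorem apply_neg_one_eq_one {F : Type*} [Field F] [Fintype F] {χ : MulChar F ℂ} (hχ : orderOf χ = 3) :
    χ (-1) = 1 := by
  have h2 : χ (-1) * χ (-1) = 1 := by rw [← map_mul, neg_one_mul, neg_neg, map_one]
  have h3 := apply_pow_three_eq_one hχ (neg_ne_zero.mpr (one_ne_zero (α := F)))
  rw [pow_succ, pow_two, h2, one_mul] at h3
  exact h3

variable [IsCyclotomicExtension {3} ℚ K]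

include hζ in
/-- **`a_p(E^k) = σ(χ) + \overline{σ(χ)}`, `χ = (k/p)·(4k/𝔭)₃·ϖ_𝔭`, at a split prime** (Ireland–Rosen Ch. 18 §3 Theorem 4:
«`N_p = p + 1 + \overline{(4D/π)}₆ π + (4D/π)₆ π̄`», `π ≡ 2 (3)` primary; here `ϖ = −π ≡ 1 (3)` and
`−\overline{(4D/π)₆} = (D/p)·(4D/𝔭)₃` since `(a/𝔭)₆⁻¹ = (a/𝔭)₂ (a/𝔭)₃`): for `p ≡ 1 (3)`, `p ∤ k`, a prime `𝔭` of `K = ℚ(ω)` over `p`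
of degree one with generator `ϖ ≡ 1 (mod 3)`, and any embedding `σ : K → ℂ`, the `p`-th coefficient of Mathlib's `L(E^k, s)` is
`z + z̄` with `z = (k/p) · σ((4k/𝔭)₃) · σ(ϖ)` (`(k/p)` the Legendre symbol, `(·/𝔭)₃ = cubicResidueSymbol 𝔭`), and `σ(ϖ)\overline{σ(ϖ)} = p`.
Proof as printed: `a_p = −Σ_x ρ(x³ + k) = −(cJ(χ, ρ) + \overline{cJ})`, `c = ρ(k)χ(−k)`, `χ = σ ∘ χ_𝔭` (`sum_quadraticChar_cube_add`),
`J(χ, ρ) = χ(4)J(χ, χ)` and `J(χ_𝔭, χ_𝔭) = −ϖ` (Ch. 9 §4 Lemma 1, the tree's `cubicJacobiSum_eq_neg_of_span_eq`), `|cJ|² = p`.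
[cite: IrelandRosen1990, Ch. 18 §3 Theorem 4 (second assertion) and its proof (PDF pp. 298–299); Ch. 9 §4 Lemma 1] -/
theorem lFunction_apply_prime_split {p : ℕ} [Fact p.Prime] (hp3 : p % 3 = 1) (hpk : ¬ (p : ℤ) ∣ k) (σ : K →+* ℂ)
    {𝔭 : HeightOneSpectrum (𝓞 K)} (hp𝔭 : (p : 𝓞 K) ∈ 𝔭.asIdeal) (hdeg : 𝔭.residueCard = p)
    {ϖ : 𝓞 K} (hϖ : Ideal.span {ϖ} = 𝔭.asIdeal) (hϖ1 : ϖ - 1 ∈ Ideal.span {(3 : 𝓞 K)}) :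
    ((mordellCurve (k : ℚ)).LFunction p : ℂ) =
        (legendreSym p k : ℂ) * σ (cubicResidueSymbol 𝔭 (Ideal.Quotient.mk 𝔭.asIdeal ((4 * k : ℤ) : 𝓞 K)) : K) * σ (ϖ : K) +
          conj ((legendreSym p k : ℂ) * σ (cubicResidueSymbol 𝔭 (Ideal.Quotient.mk 𝔭.asIdeal ((4 * k : ℤ) : 𝓞 K)) : K) *
            σ (ϖ : K)) ∧
      σ (ϖ : K) * conj (σ (ϖ : K)) = p := by
  have hp : p.Prime := Fact.out
  have h2 : p ≠ 2 := by rintro rfl; norm_num at hp3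
  have h3 : p ≠ 3 := by rintro rfl; norm_num at hp3
  obtain ⟨h2', h3'⟩ := two_three_ne_zero_zmod hp h2 h3
  have hft := lFunction_apply_prime_eq_neg_sum (k := k) h2 h3 hpk
  -- the residue field `F` of `𝔭` has `p` elements
  letI := Ideal.Quotient.field 𝔭.asIdeal
  letI := Fintype.ofFinite (𝓞 K ⧸ 𝔭.asIdeal)
  have hcardF : Fintype.card (𝓞 K ⧸ 𝔭.asIdeal) = p := by
    rw [← Nat.card_eq_fintype_card, ← HeightOneSpectrum.residueCard_eq_card_quotient, hdeg]
  haveI hchar : CharP (𝓞 K ⧸ 𝔭.asIdeal) p := charP_quotient_of_natCast_mem (K := K) hp𝔭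
  have hpF : ringChar (𝓞 K ⧸ 𝔭.asIdeal) ≠ 2 := by rw [ringChar.eq _ p]; exact h2
  have h3𝔭 : (3 : 𝓞 K) ∉ 𝔭.asIdeal := by
    refine three_not_mem_of_natCast_mem hp𝔭 ?_
    rw [Nat.coprime_comm, Nat.Prime.coprime_iff_not_dvd Nat.prime_three]
    intro h
    exact h3 ((Nat.prime_dvd_prime_iff_eq Nat.prime_three hp).mp h).symm
  -- the isomorphism `e : 𝔽_p ≃ F` and the transported sum
  set e : ZMod p ≃+* 𝓞 K ⧸ 𝔭.asIdeal := ZMod.ringEquivOfPrime (𝓞 K ⧸ 𝔭.asIdeal) hp hcardF with he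
  set B : ZMod p := (k : ZMod p) with hB
  have hB0 : B ≠ 0 := by
    rw [hB, Ne, ZMod.intCast_zmod_eq_zero_iff_dvd]; exact hpk
  set B' : 𝓞 K ⧸ 𝔭.asIdeal := e B with hB'
  have hB'0 : B' ≠ 0 := (map_ne_zero e).mpr hB0
  have hB'k : B' = Ideal.Quotient.mk 𝔭.asIdeal (k : 𝓞 K) := by
    rw [hB', hB, map_intCast]; rfl
  set ρ : MulChar (𝓞 K ⧸ 𝔭.asIdeal) ℂ :=
    (quadraticChar (𝓞 K ⧸ 𝔭.asIdeal)).ringHomComp (Int.castRingHom ℂ) with hρ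
  have hρapp : ∀ y, ρ y = ((quadraticChar (𝓞 K ⧸ 𝔭.asIdeal) y : ℤ) : ℂ) := fun y ↦ by
    rw [hρ, MulChar.ringHomComp_apply, eq_intCast]
  have hsum : ((mordellCurve (k : ℚ)).LFunction p : ℂ) = -∑ y : 𝓞 K ⧸ 𝔭.asIdeal, ρ (y ^ 3 + B') := by
    rw [hft, Int.cast_neg, Int.cast_sum]
    congr 1
    refine Fintype.sum_equiv e.toEquiv _ _ fun x ↦ ?_
    rw [hρapp, RingEquiv.toEquiv_eq_coe, EquivLike.coe_coe, hB', ← map_pow, ← map_add,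
      quadraticChar_ringEquiv_apply]
  -- the cubic character `χ = σ ∘ χ_𝔭` on `F`, of order `3`
  set τ : 𝓞 K →+* ℂ := σ.comp (algebraMap (𝓞 K) K) with hτ
  have hτapp : ∀ x : 𝓞 K, τ x = σ (x : K) := fun x ↦ rfl
  have hτinj : Function.Injective τ :=
    σ.injective.comp (FaithfulSMul.algebraMap_injective (𝓞 K) K)
  set χ₀ := cubicResidueChar hζ 𝔭 h3𝔭 with hχ₀def
  set χ : MulChar (𝓞 K ⧸ 𝔭.asIdeal) ℂ := χ₀.ringHomComp τ with hχdef
  have hχapp : ∀ a, χ a = τ (cubicResidueSymbol 𝔭 a) := fun a ↦ rfl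
  have hχ3 : χ ^ 3 = 1 := by
    rw [hχdef, MulChar.ringHomComp_pow, hχ₀def, cubicResidueChar_pow_three hζ h3𝔭,
      MulChar.ringHomComp_one]
  have hχne : χ ≠ 1 := by
    intro h1
    obtain ⟨g, hg⟩ := IsCyclic.exists_generator (α := (𝓞 K ⧸ 𝔭.asIdeal)ˣ)
    have hg3 : cubicResidueSymbol 𝔭 (g : 𝓞 K ⧸ 𝔭.asIdeal) ≠ 1 := by
      intro hg1
      have hspec := (cubicResidueSymbol_spec hζ h3𝔭 (Units.ne_zero g)).2
      rw [hg1, map_one] at hspec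
      have hord : orderOf g = Fintype.card (𝓞 K ⧸ 𝔭.asIdeal) - 1 := by
        rw [orderOf_eq_card_of_forall_mem_zpowers hg, Nat.card_eq_fintype_card, Fintype.card_units]
      have hcardF' : Fintype.card (𝓞 K ⧸ 𝔭.asIdeal) = 𝔭.residueCard := by
        rw [HeightOneSpectrum.residueCard_eq_card_quotient, Nat.card_eq_fintype_card]
      have hdvd := orderOf_dvd_of_pow_eq_one (x := g) (n := (𝔭.residueCard - 1) / 3)
        (Units.ext (by rw [Units.val_pow_eq_pow_val, Units.val_one, ← hspec]))
      rw [hord, hcardF'] at hdvd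
      have hpos := residueCard_sub_one_div_three_ne_zero hζ h3𝔭 (𝔭 := 𝔭)
      have h3dvd := three_dvd_residueCard_sub_one hζ h3𝔭 (𝔭 := 𝔭)
      have hle := Nat.le_of_dvd (Nat.pos_of_ne_zero hpos) hdvd
      omega
    apply hg3
    apply hτinj
    have h := congrArg (fun χ' : MulChar (𝓞 K ⧸ 𝔭.asIdeal) ℂ ↦ χ' (g : 𝓞 K ⧸ 𝔭.asIdeal)) h1
    simp only [hχapp, MulChar.one_apply_coe] at h
    rw [h, map_one]
  have hordχ : orderOf χ = 3 := orderOf_eq_prime hχ3 hχne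
  -- Ireland–Rosen's count and the two Jacobi-sum identities
  have key := sum_quadraticChar_cube_add hpF hordχ hB'0
  rw [← hρ] at key
  have hJρ : jacobiSum χ ρ = χ 4 * jacobiSum χ χ :=
    jacobiSum_quadraticChar_eq_mul_jacobiSum_self hpF hχne
  have hJJ : jacobiSum χ χ = -τ ϖ := by
    rw [hχdef, jacobiSum_ringHomComp, hχ₀def, ← cubicJacobiSum_eq hζ 𝔭 h3𝔭,
      cubicJacobiSum_eq_neg_of_span_eq hζ 𝔭 h3𝔭 hϖ hϖ1, map_neg]
  have hnorm := jacobiSum_mul_conj hpF hordχ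
  rw [← hρ, hcardF] at hnorm
  -- unit-modulus factors
  have hρB : ρ B' * conj (ρ B') = 1 := by
    rw [hρapp]
    rcases quadraticChar_dichotomy hB'0 with h | h <;> simp [h]
  have h40 : (4 : 𝓞 K ⧸ 𝔭.asIdeal) ≠ 0 := by
    rw [show (4 : 𝓞 K ⧸ 𝔭.asIdeal) = e 4 by rw [map_ofNat]]
    refine (map_ne_zero e).mpr ?_
    rw [show (4 : ZMod p) = 2 ^ 2 by norm_num]
    exact pow_ne_zero _ h2'
  have hχ4 : χ 4 * conj (χ 4) = 1 := by
    rw [conj_apply_eq_sq hordχ, ← pow_succ', apply_pow_three_eq_one hordχ h40]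
  have hϖϖ : τ ϖ * conj (τ ϖ) = p := by
    have hJ : jacobiSum χ ρ * conj (jacobiSum χ ρ) = (χ 4 * conj (χ 4)) * (τ ϖ * conj (τ ϖ)) := by
      rw [hJρ, hJJ, map_mul, map_neg]; ring
    rw [hnorm, hχ4, one_mul] at hJ
    exact hJ.symm
  -- `z = c J(χ, ρ) = −(ρ(k) χ(4k) τ ϖ)`
  have hneg1 : χ (-1) = 1 := apply_neg_one_eq_one hordχ
  have hz : ρ B' * χ (-B') * jacobiSum χ ρ = -(ρ B' * χ (4 * B') * τ ϖ) := by
    rw [hJρ, hJJ, show -B' = (-1) * B' by ring, map_mul, hneg1, one_mul, map_mul]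
    ring
  have ha : ((mordellCurve (k : ℚ)).LFunction p : ℂ) = ρ B' * χ (4 * B') * τ ϖ + conj (ρ B' * χ (4 * B') * τ ϖ) := by
    rw [hsum, key, hz, map_neg]; ring
  -- identify the three factors
  have hρk : ρ B' = (legendreSym p k : ℂ) := by
    rw [hρapp, hB', quadraticChar_ringEquiv_apply, hB, legendreSym]
  have h4B : (4 : 𝓞 K ⧸ 𝔭.asIdeal) * B' = Ideal.Quotient.mk 𝔭.asIdeal ((4 * k : ℤ) : 𝓞 K) := by
    rw [hB'k]; push_cast; rw [map_mul, map_ofNat]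
  have hχ4k : χ (4 * B') = σ (cubicResidueSymbol 𝔭 (Ideal.Quotient.mk 𝔭.asIdeal ((4 * k : ℤ) : 𝓞 K)) : K) := by
    rw [hχapp, h4B, hτapp]
  refine ⟨?_, by rw [← hτapp]; exact hϖϖ⟩
  rw [ha, hρk, hχ4k, hτapp]

include hζ in
/-- **The split Euler factor `(1 − σ(χ) p^{−s})(1 − \overline{σ(χ)} p^{−s})`**: with the data of `lFunction_apply_prime_split` and
`z = (k/p)·σ((4k/𝔭)₃)·σ(ϖ)`, `a_{p^j}(E^k) = Σ_{i ≤ j} z^i z̄^{j−i}` (good reduction at `p`, recursion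
`a_{p^{j+2}} = a_p a_{p^{j+1}} − p a_{p^j}`, `z z̄ = p`). [cite: IrelandRosen1990, Ch. 18 §7 (the Euler factor at a split prime)] [cite: DiamondShurman2005, §8.8 (8.44)] -/
theorem lFunction_apply_prime_pow_split {p : ℕ} [Fact p.Prime] (hp3 : p % 3 = 1) (hpk : ¬ (p : ℤ) ∣ k) (σ : K →+* ℂ)
    {𝔭 : HeightOneSpectrum (𝓞 K)} (hp𝔭 : (p : 𝓞 K) ∈ 𝔭.asIdeal) (hdeg : 𝔭.residueCard = p)
    {ϖ : 𝓞 K} (hϖ : Ideal.span {ϖ} = 𝔭.asIdeal) (hϖ1 : ϖ - 1 ∈ Ideal.span {(3 : 𝓞 K)}) (j : ℕ) :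
    ((mordellCurve (k : ℚ)).LFunction (p ^ j) : ℂ) =
      ∑ i ∈ Finset.range (j + 1),
        ((legendreSym p k : ℂ) * σ (cubicResidueSymbol 𝔭 (Ideal.Quotient.mk 𝔭.asIdeal ((4 * k : ℤ) : 𝓞 K)) : K) *
            σ (ϖ : K)) ^ i *
          conj ((legendreSym p k : ℂ) * σ (cubicResidueSymbol 𝔭 (Ideal.Quotient.mk 𝔭.asIdeal ((4 * k : ℤ) : 𝓞 K)) : K) *
            σ (ϖ : K)) ^ (j - i) := by
  have hp : p.Prime := Fact.out
  have h2 : p ≠ 2 := by rintro rfl; norm_num at hp3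
  have h3 : p ≠ 3 := by rintro rfl; norm_num at hp3
  obtain ⟨h1, hϖϖ⟩ := lFunction_apply_prime_split hζ (k := k) hp3 hpk σ hp𝔭 hdeg hϖ hϖ1
  set E : WeierstrassCurve ℚ := mordellCurve (k : ℚ) with hE
  obtain ⟨v, hv⟩ := exists_natGenerator_eq' hp
  have hgood : E.HasGoodReductionAt v := hasGoodReductionAt_of_not_dvd v (by rw [hv]; exact h2) (by rw [hv]; exact h3)
    (by rw [hv]; exact hpk)
  have hrec : ∀ j, E.LFunction (p ^ (j + 2)) = E.LFunction p * E.LFunction (p ^ (j + 1)) - (p : ℤ) * E.LFunction (p ^ j) := by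
    intro j
    have h := E.LFunction_apply_prime_pow_add_two v j
    rw [if_pos hgood] at h
    rw [← hv]
    exact h
  set z : ℂ := (legendreSym p k : ℂ) * σ (cubicResidueSymbol 𝔭 (Ideal.Quotient.mk 𝔭.asIdeal ((4 * k : ℤ) : 𝓞 K)) : K) *
    σ (ϖ : K) with hz
  -- `z z̄ = p`
  have hkp : (legendreSym p k : ℂ) * conj (legendreSym p k : ℂ) = 1 := by
    rw [map_intCast, ← Int.cast_mul, ← sq, legendreSym.sq_one p (by rwa [Ne, ZMod.intCast_zmod_eq_zero_iff_dvd])]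
    simp
  have hcube : cubicResidueSymbol 𝔭 (Ideal.Quotient.mk 𝔭.asIdeal ((4 * k : ℤ) : 𝓞 K)) ^ 3 = 1 := by
    have h3𝔭 : (3 : 𝓞 K) ∉ 𝔭.asIdeal := by
      refine three_not_mem_of_natCast_mem hp𝔭 ?_
      rw [Nat.coprime_comm, Nat.Prime.coprime_iff_not_dvd Nat.prime_three]
      intro h
      exact h3 ((Nat.prime_dvd_prime_iff_eq Nat.prime_three hp).mp h).symm
    refine (cubicResidueSymbol_spec hζ h3𝔭 ?_).1
    letI := Ideal.Quotient.field 𝔭.asIdeal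
    haveI hchar : CharP (𝓞 K ⧸ 𝔭.asIdeal) p := charP_quotient_of_natCast_mem (K := K) hp𝔭
    intro h0
    rw [Ideal.Quotient.eq_zero_iff_mem] at h0
    -- `4k ∈ 𝔭` contradicts `p ∤ 4k` (as `𝔭 ∩ ℤ = pℤ`)
    have h4k : ((4 * k : ℤ) : 𝓞 K ⧸ 𝔭.asIdeal) = 0 := by
      rw [← map_intCast (Ideal.Quotient.mk 𝔭.asIdeal), Ideal.Quotient.eq_zero_iff_mem]; exact h0
    rw [CharP.intCast_eq_zero_iff (𝓞 K ⧸ 𝔭.asIdeal) p] at h4k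
    rcases (Nat.prime_iff_prime_int.mp hp).dvd_or_dvd h4k with h4 | hk'
    · have : p ∣ 2 ^ 2 := by exact_mod_cast h4
      exact h2 ((Nat.prime_dvd_prime_iff_eq hp Nat.prime_two).mp (hp.dvd_of_dvd_pow this))
    · exact hpk hk'
  have hχχ : σ (cubicResidueSymbol 𝔭 (Ideal.Quotient.mk 𝔭.asIdeal ((4 * k : ℤ) : 𝓞 K)) : K) *
      conj (σ (cubicResidueSymbol 𝔭 (Ideal.Quotient.mk 𝔭.asIdeal ((4 * k : ℤ) : 𝓞 K)) : K)) = 1 := by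
    set τ : 𝓞 K →+* ℂ := σ.comp (algebraMap (𝓞 K) K) with hτ
    set w : ℂ := σ (cubicResidueSymbol 𝔭 (Ideal.Quotient.mk 𝔭.asIdeal ((4 * k : ℤ) : 𝓞 K)) : K) with hw
    have hwτ : w = τ (cubicResidueSymbol 𝔭 (Ideal.Quotient.mk 𝔭.asIdeal ((4 * k : ℤ) : 𝓞 K))) := rfl
    have hw3 : w ^ 3 = 1 := by rw [hwτ, ← map_pow, hcube, map_one]
    rw [conj_eq_inv_of_pow_eq_one three_ne_zero hw3, mul_inv_cancel₀]
    intro h0; rw [h0] at hw3; norm_num at hw3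
  have hzz : z * conj z = p := by
    calc z * conj z = ((legendreSym p k : ℂ) * conj (legendreSym p k : ℂ)) *
          (σ (cubicResidueSymbol 𝔭 (Ideal.Quotient.mk 𝔭.asIdeal ((4 * k : ℤ) : 𝓞 K)) : K) *
            conj (σ (cubicResidueSymbol 𝔭 (Ideal.Quotient.mk 𝔭.asIdeal ((4 * k : ℤ) : 𝓞 K)) : K))) *
          (σ (ϖ : K) * conj (σ (ϖ : K))) := by rw [hz, map_mul, map_mul]; ring
      _ = p := by rw [hkp, hχχ, hϖϖ, one_mul, one_mul]
  set T : ℕ → ℂ := fun j ↦ ∑ i ∈ Finset.range (j + 1), z ^ i * conj z ^ (j - i) with hT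
  suffices H : ∀ j, ((E.LFunction (p ^ j) : ℤ) : ℂ) = T j ∧ ((E.LFunction (p ^ (j + 1)) : ℤ) : ℂ) = T (j + 1) from
    (H j).1
  intro j
  induction j with
  | zero =>
    constructor
    · rw [pow_zero, E.isMultiplicative_LFunction.map_one]; simp [hT]
    · rw [zero_add, pow_one, h1]
      simp only [hT, Finset.sum_range_succ, Finset.sum_range_zero, pow_zero, pow_one, Nat.sub_zero, Nat.sub_self,
        one_mul, mul_one, zero_add]
      ring
  | succ j ih =>
    refine ⟨ih.2, ?_⟩
    rw [show j + 1 + 1 = j + 2 by ring, hrec j, Int.cast_sub, Int.cast_mul, Int.cast_mul, ih.1, ih.2, h1,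
      Int.cast_natCast, ← hzz]
    have hTrec : T (j + 2) = (z + conj z) * T (j + 1) - z * conj z * T j := by
      simp only [hT]
      exact Literature.NumberTheory.QuadraticFields.GaussianPrimary.sum_pow_mul_pow_rec z (conj z) j
    rw [hTrec]

end Split

end SexticTwist

end Literature.NumberTheory.EllipticCurves

end
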